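import Summits.QuantumFields.BalabanUV.Beta.EriceRemainderEnclosureHistoryUniqueness

/-!
# EriceRemainderEnclosureHistoryUniquenessSharp — (E32b) THE SMALLNESS IS LOAD-BEARING, THE DECAY IS NOT: an integer family with
# ALL its memory on the bare coupling, the printed split, (AF-1), floor and sign, whose tuned bare coupling is NOT unique on the
# unit box (two runs `1∕g² = (4,3,2,1)` and `(16,11,6,1)` pinned at `g_3 = 1`) and IS unique, for every cutoff, on the box ]0, 1∕100]

Cell `pub-balaban`, β-function sub-cell, BINDER row D4 «RemainderConst leaves for Bałaban's split» (`HOME/BINDER-OWNERS.md`; owner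
lineage `b2b-balaban-beta-an4`; this file by co-owner #2 lineage `b2b-balaban-beta-d4-p2`, generation 34), β-FLOW TEAM duty (1),
FREEZE (0) honoured (def-free; the lineage's `EriceRemainderEnclosure*` series).  Companion of (E32) `EriceRemainderEnclosureHistoryUniqueness`
(imported; its END `eq_of_pin_rowSum_sign` is fired BY NAME in §4).

HONEST FRAMING (page 1, verbatim and binding).  *"Discharging BetaPertH makes Bałaban's UV stability UNCONDITIONAL — a real
constructive-QFT result; it is NOT the continuum limit and NOT the Clay problem."*  THIS FILE DISCHARGES NOTHING OF THE KIND.  The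
family below is a TEST OBJECT for the typed hypothesis SHAPES of node U2 (`T4CouplingMatching.HistLipschitz` ∕ `FadingMemory` ∕
`EventualLowerH`, `FlowStep.BetaLowerH` ∕ `BetaUpperH` ∕ `BetaContH`) and of row D4 (`B12Beta.OneLoopSplit`, (AF-1)), NOT a model of
[I] (1.22); «uniqueness» = of the tuned bare coupling of the SCALAR recursion (0.20) at fixed cutoff.  Row D4 class UNCHANGED
(critical-path width 0; instance 0∕1; D4 DISCHARGE NO DATE).  HONEST DEPENDENCY: continuum YM on T⁴ ⇐ BetaPertH ∧ nine spine
estimates (0/9 proved); BetaPertH ⇐ (D1) ∧ (D4) ∧ CAP+tail; G-an2-4 gates asym, D1 and NE2/3/4.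

THE FAMILY (a hypothesis `hβ` on an abstract `β : HBeta`): `β_{k+1}(g_0,…,g_k) = 1 + 16·(1∕2 − g_0)₊·min(1, 4g_k)`.  One-loop part `1`;
remainder `16·(1∕2 − g_0)₊·min(1, 4g_k)` — vanishes at `g_k = 0` (PRINTED split), `≤ 32·g_k` ((AF-1)), `≥ 0` (sign, floor `b = 1` from
`k₀ = 0`), `≤ 8` (two-sided bound `β′ = 9`), jointly continuous, history-Lipschitz with moduli `Λ k i = 16·[i = 0] + 32·[i = k]` (ROW
total weight 48 at every scale).  ALL the memory sits on the BARE coupling `g_0` and NEVER fades: every history-Lipschitz modulus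
`Λ′` of the family on a box ]0,γ] with `γ ≥ 1∕2` has `Λ′ k 0 ≥ 16` at EVERY scale `k` (§2), so NO `FadingMemory C θ Λ′` with `θ < 1`
exists and the column sums `Σ_{k<K} Λ′ k 0 ≥ 16K` are unbounded — node U2's uniqueness theorems (`T4TwoRunUniqueness.eq_of_pin_*`,
all under `FadingMemory`) are VACUOUS for it, (E32)'s row-sum theorems are not.

THE TWO RUNS (§3).  `g^A = (1∕2, 1∕√3, 1∕√2, 1)` and `g^B = (1∕4, 1∕√11, 1∕√6, 1)`, i.e. `1∕(g^A)² = (4, 3, 2, 1)` (memory term `0`, β ≡ 1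
along A) and `1∕(g^B)² = (16, 11, 6, 1)` (memory term `16·(1∕4)·1 = 4`, β ≡ 5 along B; `min(1, 4g_k) = 1` since `4∕√11, 4∕√6 ≥ 1`):
both solve (0.20) for K = 3, both lie in ]0, 1], both are pinned at `g_3 = 1`, and `g^A_0 = 1∕2 ≠ 1∕4 = g^B_0`.  (By inspection, not
kernel-checked: each ONE-STEP map `1∕g_k² ↦ 1∕g_{k+1}²` of the family is injective on the box — the non-uniqueness is a MEMORY effect
accumulated over three steps, cf. node U2's `T4BetaFlowWellPosed` §8 «scale-wise injectivity does not suffice».)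

WHAT THIS DECIDES (census sense (α)).  Every binder of (E32) `eq_of_pin_rowSum_sign` holds for the family on the unit box — runs,
box, pin, `HistLipschitz` with rows ≤ 48, sign, floor `b = 1` from `k₀ = 0` — EXCEPT the smallness: `M·((k₀+1)γ³ + 2γ∕b) = 48·3 = 144`;
and the conclusion FAILS (§4 `rowSum_smallness_loadBearing`).  On the box ]0, 1∕100] the same family, same moduli, same floor has
`48·(γ³ + 2γ) < 1` and (E32) gives uniqueness for EVERY cutoff `K` (§4 `unique_on_small_box`).  So, for the uniqueness leg, the
history enters through the dimensionless product `M·γ∕b` (node U2's `T4BetaFlowWellPosed` §7 ratio `Cm·γ < b(1−θ)`, in row-sum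
currency) and through NOTHING ELSE: no decay rate, no column bound, no moment of the memory is load-bearing — the exact opposite of the
two-loop VALUE ((E30b): bounded total weight does NOT fix the value; first ∕ log age-moment needed).

CONTENT ([folklore]; 0 `def`, 0 sorry).  §1 shapes of the family (`fam_split`, `fam_af1`, `fam_lower`, `fam_upper`, `fam_cont`,
`fam_histLipschitz`, `fam_rowSum`); §2 `fam_weight_ge` (Λ′ k 0 ≥ 16), `fam_not_fadingMemory`, `fam_colSum_ge`; §3 the runs
(`runA_rgEqH`, `runB_rgEqH`, boxes, pin, distinct bare values); §4 ENDs `rowSum_smallness_loadBearing` (∃-package) and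
`unique_on_small_box` ((E32) BY NAME).
-/

noncomputable section

open Finset

namespace Summit.QuantumFields.BalabanUV.Beta.EriceRemainderEnclosureHistoryUniquenessSharp

open Literature.MathematicalPhysics.QuantumFieldTheory.Balaban1983to89
open Literature.MathematicalPhysics.QuantumFieldTheory.Balaban1983to89.FlowStep
open Literature.MathematicalPhysics.QuantumFieldTheory.Balaban1983to89.T4CouplingMatching
open Summit.QuantumFields.BalabanUV.Beta.EriceRemainderEnclosureHistoryUniqueness (eq_of_pin_rowSum_sign)

variable {β : HBeta}

/-! ## §1 The family `β_{k+1}(g_0,…,g_k) = 1 + 16·(1∕2 − g_0)₊·min(1, 4g_k)` and its shapes -/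

/-- The memory factor is between `0` and `1∕2` for `g_0 ≥ 0`. [folklore] -/
theorem mem_factor_bounds {x : ℝ} (hx : 0 ≤ x) : 0 ≤ max 0 (1 / 2 - x) ∧ max 0 (1 / 2 - x) ≤ 1 / 2 :=
  ⟨le_max_left _ _, max_le (by norm_num) (by linarith)⟩

/-- The cutoff factor is between `0` and `1` for `g_k ≥ 0`, and at most `4g_k`. [folklore] -/
theorem cut_factor_bounds {y : ℝ} (hy : 0 ≤ y) :
    0 ≤ min 1 (4 * y) ∧ min 1 (4 * y) ≤ 1 ∧ min 1 (4 * y) ≤ 4 * y :=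
  ⟨le_min zero_le_one (by linarith), min_le_left _ _, min_le_right _ _⟩

/-- A PRINTED split of the family: one-loop part `1`, remainder `16·(1∕2 − g_0)₊·min(1, 4g_k)`, which vanishes at `g_k = 0`.
[cite: Balaban1987RG1, (2.12)–(2.14) p.268] -/
theorem fam_split (hβ : ∀ (k : ℕ) (p : Fin (k + 1) → ℝ), β k p = 1 + 16 * max 0 (1 / 2 - p 0) * min 1 (4 * p (Fin.last k))) :
    ∃ S : B12Beta.OneLoopSplit β, (∀ k, S.β0 k = 1) ∧
      ∀ k p, S.β1 k p = 16 * max 0 (1 / 2 - p 0) * min 1 (4 * p (Fin.last k)) :=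
  ⟨{ β0 := fun _ => 1
     β1 := fun k p => 16 * max 0 (1 / 2 - p 0) * min 1 (4 * p (Fin.last k))
     split := fun k p => hβ k p
     vanish := fun k p hp => by simp [hp] }, fun _ => rfl, fun _ _ => rfl⟩

/-- (AF-1) for the family's remainder: `|16·(1∕2 − g_0)₊·min(1, 4g_k)| ≤ 32·g_k` on the boxes. [folklore] -/
theorem fam_af1 {γ : ℝ} {k : ℕ} {p : Fin (k + 1) → ℝ} (hp : p ∈ Box γ k) :
    |16 * max 0 (1 / 2 - p 0) * min 1 (4 * p (Fin.last k))| ≤ 32 * p (Fin.last k) := by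
  have h0 := mem_factor_bounds ((mem_box.mp hp) 0).1.le
  have hk := cut_factor_bounds ((mem_box.mp hp) (Fin.last k)).1.le
  rw [abs_of_nonneg (by have := h0.1; have := hk.1; positivity)]
  nlinarith [h0.1, h0.2, hk.1, hk.2.2]

/-- SIGN and FLOOR: `β ≥ 1` on every box (so `BetaLowerH 1 γ β`, `BetaLowerH 0 γ β`, `EventualLowerH 1 γ 0 β`). [folklore] -/
theorem fam_lower (hβ : ∀ (k : ℕ) (p : Fin (k + 1) → ℝ), β k p = 1 + 16 * max 0 (1 / 2 - p 0) * min 1 (4 * p (Fin.last k)))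
    (γ : ℝ) : BetaLowerH 1 γ β := by
  intro k p hp
  have h0 := mem_factor_bounds ((mem_box.mp hp) 0).1.le
  have hk := cut_factor_bounds ((mem_box.mp hp) (Fin.last k)).1.le
  rw [hβ]; nlinarith [h0.1, hk.1]

/-- Two-sided bound: `β ≤ 9` on every box. [folklore] -/
theorem fam_upper (hβ : ∀ (k : ℕ) (p : Fin (k + 1) → ℝ), β k p = 1 + 16 * max 0 (1 / 2 - p 0) * min 1 (4 * p (Fin.last k)))
    (γ : ℝ) : BetaUpperH 9 γ β := by
  intro k p hp
  have h0 := mem_factor_bounds ((mem_box.mp hp) 0).1.le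
  have hk := cut_factor_bounds ((mem_box.mp hp) (Fin.last k)).1.le
  rw [hβ]; nlinarith [h0.1, h0.2, hk.1, hk.2.1]

/-- Joint continuity in the history (`FlowStep.BetaContH`). [folklore] -/
theorem fam_cont (hβ : ∀ (k : ℕ) (p : Fin (k + 1) → ℝ), β k p = 1 + 16 * max 0 (1 / 2 - p 0) * min 1 (4 * p (Fin.last k)))
    (γ : ℝ) : BetaContH γ β := by
  intro k
  have e : β k = fun p => 1 + 16 * max 0 (1 / 2 - p 0) * min 1 (4 * p (Fin.last k)) := funext (hβ k)
  rw [e]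
  exact Continuous.continuousOn (by fun_prop)

/-- HISTORY-LIPSCHITZ with ALL memory on the bare coupling: moduli `Λ k i = 16·[i = 0] + 32·[i = k]`, on EVERY box. [folklore] -/
theorem fam_histLipschitz
    (hβ : ∀ (k : ℕ) (p : Fin (k + 1) → ℝ), β k p = 1 + 16 * max 0 (1 / 2 - p 0) * min 1 (4 * p (Fin.last k))) (γ : ℝ) :
    HistLipschitz (fun k i => (if i = 0 then 16 else 0) + (if i = k then 32 else 0)) γ β := by
  intro k p q hp hq
  set m₁ := max 0 (1 / 2 - p 0); set m₂ := max 0 (1 / 2 - q 0)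
  set n₁ := min 1 (4 * p (Fin.last k)); set n₂ := min 1 (4 * q (Fin.last k))
  have hm₂ := mem_factor_bounds ((mem_box.mp hq) 0).1.le
  have hn₁ := cut_factor_bounds ((mem_box.mp hp) (Fin.last k)).1.le
  have hdm : |m₁ - m₂| ≤ |p 0 - q 0| := by
    calc |m₁ - m₂| ≤ max |(0 : ℝ) - 0| |(1 / 2 - p 0) - (1 / 2 - q 0)| := abs_max_sub_max_le_max _ _ _ _
      _ = |p 0 - q 0| := by
          rw [sub_self, abs_zero, show (1 / 2 - p 0) - (1 / 2 - q 0) = -(p 0 - q 0) by ring, abs_neg,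
            max_eq_right (abs_nonneg _)]
  have hdn : |n₁ - n₂| ≤ 4 * |p (Fin.last k) - q (Fin.last k)| := by
    calc |n₁ - n₂| ≤ max |(1 : ℝ) - 1| |4 * p (Fin.last k) - 4 * q (Fin.last k)| := abs_min_sub_min_le_max _ _ _ _
      _ = 4 * |p (Fin.last k) - q (Fin.last k)| := by
          rw [sub_self, abs_zero, ← mul_sub, abs_mul, abs_of_pos (by norm_num : (0:ℝ) < 4), max_eq_right (by positivity)]
  have hsum : ∑ i : Fin (k + 1), ((if i = 0 then (16 : ℝ) else 0) + (if i = Fin.last k then 32 else 0)) * |p i - q i|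
      = 16 * |p 0 - q 0| + 32 * |p (Fin.last k) - q (Fin.last k)| := by
    simp only [add_mul, sum_add_distrib, ite_mul, zero_mul, sum_ite_eq', mem_univ, if_true]
  have e1 : ∀ i : Fin (k + 1), ((i : ℕ) = 0) ↔ (i = 0) := fun i => by rw [Fin.ext_iff, Fin.val_zero]
  have e2 : ∀ i : Fin (k + 1), ((i : ℕ) = k) ↔ (i = Fin.last k) := fun i => by rw [Fin.ext_iff, Fin.val_last]
  have e : ∑ i : Fin (k + 1), ((if (i : ℕ) = 0 then (16 : ℝ) else 0) + (if (i : ℕ) = k then 32 else 0)) * |p i - q i|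
      = 16 * |p 0 - q 0| + 32 * |p (Fin.last k) - q (Fin.last k)| := by
    simp_rw [e1, e2]; exact hsum
  show |β k p - β k q| ≤
    ∑ i : Fin (k + 1), ((if (i : ℕ) = 0 then (16 : ℝ) else 0) + (if (i : ℕ) = k then 32 else 0)) * |p i - q i|
  rw [e, hβ, hβ]
  have key : (1 + 16 * m₁ * n₁) - (1 + 16 * m₂ * n₂) = 16 * ((m₁ - m₂) * n₁ + m₂ * (n₁ - n₂)) := by ring
  rw [key, abs_mul, abs_of_pos (by norm_num : (0:ℝ) < 16)]
  have h1 : |(m₁ - m₂) * n₁| ≤ |p 0 - q 0| := by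
    rw [abs_mul, abs_of_nonneg hn₁.1]; nlinarith [abs_nonneg (m₁ - m₂), hn₁.2.1]
  have h2 : |m₂ * (n₁ - n₂)| ≤ 2 * |p (Fin.last k) - q (Fin.last k)| := by
    rw [abs_mul, abs_of_nonneg hm₂.1]; nlinarith [abs_nonneg (n₁ - n₂), hm₂.2]
  linarith [abs_add_le ((m₁ - m₂) * n₁) (m₂ * (n₁ - n₂))]

/-- The moduli are nonnegative with ROW total weight `≤ 48` at every scale. [folklore] -/
theorem fam_rowSum (k : ℕ) :
    (∀ i, i ≤ k → (0 : ℝ) ≤ (if i = 0 then 16 else 0) + (if i = k then 32 else 0)) ∧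
      ∑ i ∈ range (k + 1), ((if i = 0 then (16 : ℝ) else 0) + (if i = k then 32 else 0)) ≤ 48 := by
  refine ⟨fun i _ => by split_ifs <;> norm_num, ?_⟩
  rw [sum_add_distrib, sum_ite_eq' (range (k + 1)) 0, sum_ite_eq' (range (k + 1)) k,
    if_pos (mem_range.mpr (Nat.succ_pos k)), if_pos (mem_range.mpr (Nat.lt_succ_self k))]
  norm_num

/-! ## §2 No fading: every history-Lipschitz modulus of the family weighs the bare coupling by at least 16 at every scale -/

/-- **THE MEMORY NEVER FADES**: if `HistLipschitz Λ′ γ β` with `γ ≥ 1∕2`, then `Λ′ k 0 ≥ 16` at EVERY scale `k` (test histories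
`(1∕4, 1∕2, …, 1∕2)` against `(1∕2, …, 1∕2)`: the family jumps by `4`, the modulus charges `Λ′ k 0·(1∕4)`). [folklore] -/
theorem fam_weight_ge (hβ : ∀ (k : ℕ) (p : Fin (k + 1) → ℝ), β k p = 1 + 16 * max 0 (1 / 2 - p 0) * min 1 (4 * p (Fin.last k)))
    {Λ' : ℕ → ℕ → ℝ} {γ : ℝ} (hγ : 1 / 2 ≤ γ) (hL : HistLipschitz Λ' γ β) (k : ℕ) : 16 ≤ Λ' k 0 := by
  set q : Fin (k + 1) → ℝ := fun _ => 1 / 2 with hq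
  set p : Fin (k + 1) → ℝ := Function.update q 0 (1 / 4) with hp
  have hqbox : q ∈ Box γ k := mem_box.mpr fun i => ⟨by norm_num [hq], by simpa [hq] using hγ⟩
  have hpbox : p ∈ Box γ k := mem_box.mpr fun i => by
    by_cases hi : i = 0
    · subst hi; simp only [hp, Function.update_self]; exact ⟨by norm_num, by linarith⟩
    · simp only [hp, Function.update_of_ne hi, hq]; exact ⟨by norm_num, hγ⟩
  have h := hL k p q hpbox hqbox
  have hp0 : p 0 = 1 / 4 := by simp [hp]
  have hmin : min 1 (4 * p (Fin.last k)) = 1 := by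
    by_cases hk : Fin.last k = 0
    · rw [hk, hp0]; norm_num
    · simp only [hp, Function.update_of_ne hk, hq]; norm_num
  have hβp : β k p = 5 := by rw [hβ, hp0, hmin]; norm_num
  have hβq : β k q = 1 := by rw [hβ]; norm_num [hq]
  have hsum : ∑ i : Fin (k + 1), Λ' k i * |p i - q i| = Λ' k 0 * (1 / 4) := by
    rw [Fintype.sum_eq_single 0 fun i hi => by simp [hp, Function.update_of_ne hi]]
    rw [hp0]; norm_num [hq]
  rw [hβp, hβq, hsum] at h
  norm_num at h
  linarith

/-- Hence NO history-Lipschitz modulus of the family has `FadingMemory C θ` with `θ < 1` — node U2's uniqueness theorems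
(`T4TwoRunUniqueness.eq_of_pin_fadingMemory` ∕ `eq_of_pin_eventualLower`) are VACUOUS for it. [folklore] -/
theorem fam_not_fadingMemory
    (hβ : ∀ (k : ℕ) (p : Fin (k + 1) → ℝ), β k p = 1 + 16 * max 0 (1 / 2 - p 0) * min 1 (4 * p (Fin.last k)))
    {Λ' : ℕ → ℕ → ℝ} {γ : ℝ} (hγ : 1 / 2 ≤ γ) (hL : HistLipschitz Λ' γ β) {C θ : ℝ} (hθ0 : 0 ≤ θ) (hθ1 : θ < 1) :
    ¬ FadingMemory C θ Λ' := by
  intro hF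
  have hw := fam_weight_ge hβ hγ hL
  rcases le_or_gt C 0 with hC | hC
  · have h := (hF 0 0 le_rfl).2
    have : C * θ ^ (0 - 0) ≤ 0 := mul_nonpos_of_nonpos_of_nonneg hC (pow_nonneg hθ0 _)
    linarith [hw 0]
  · obtain ⟨n, hn⟩ := exists_pow_lt_of_lt_one (div_pos (by norm_num : (0:ℝ) < 16) hC) hθ1
    have h := (hF n 0 (Nat.zero_le n)).2
    rw [Nat.sub_zero] at h
    have : C * θ ^ n < 16 := by rwa [lt_div_iff₀ hC, mul_comm] at hn
    linarith [hw n]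

/-- … and the COLUMN of the bare coupling is unsummable: `Σ_{k<K} Λ′ k 0 ≥ 16K`. [folklore] -/
theorem fam_colSum_ge (hβ : ∀ (k : ℕ) (p : Fin (k + 1) → ℝ), β k p = 1 + 16 * max 0 (1 / 2 - p 0) * min 1 (4 * p (Fin.last k)))
    {Λ' : ℕ → ℕ → ℝ} {γ : ℝ} (hγ : 1 / 2 ≤ γ) (hL : HistLipschitz Λ' γ β) (K : ℕ) :
    16 * (K : ℝ) ≤ ∑ k ∈ range K, Λ' k 0 := by
  have h := card_nsmul_le_sum (range K) (fun k => Λ' k 0) 16 fun k _ => fam_weight_ge hβ hγ hL k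
  simpa [mul_comm] using h

/-! ## §3 The two runs `1∕(g^A)² = (4,3,2,1)` and `1∕(g^B)² = (16,11,6,1)` -/

/-- Run A solves (0.20) for K = 3 with the family (memory term `0`, β ≡ 1 along it). [cite: Balaban1987RG1, (0.20) p.256] -/
theorem runA_rgEqH (hβ : ∀ (k : ℕ) (p : Fin (k + 1) → ℝ), β k p = 1 + 16 * max 0 (1 / 2 - p 0) * min 1 (4 * p (Fin.last k)))
    {gA : ℕ → ℝ} (hA : ∀ k : ℕ, gA k = 1 / Real.sqrt (4 - (k : ℝ))) : RGEqH 3 β gA := by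
  have key : ∀ a : ℝ, 0 ≤ a → 1 / (1 / Real.sqrt a) ^ 2 = a := fun a ha => by
    rw [div_pow, one_pow, Real.sq_sqrt ha, one_div_one_div]
  have h4 : Real.sqrt 4 = 2 := by rw [show (4 : ℝ) = 2 ^ 2 by norm_num]; exact Real.sqrt_sq (by norm_num)
  have hA0 : gA 0 = 1 / 2 := by rw [hA]; simp [h4]
  intro k hk
  have hkr : (k : ℝ) ≤ 2 := by exact_mod_cast (by omega : k ≤ 2)
  rw [hβ, prefixOf_apply, Fin.val_zero, hA0]
  rw [show (1 : ℝ) + 16 * max 0 (1 / 2 - 1 / 2) * min 1 (4 * prefixOf gA k (Fin.last k)) = 1 by simp]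
  rw [hA k, hA (k + 1), key _ (by linarith), key _ (by push_cast; linarith)]
  push_cast; ring

/-- Run B solves (0.20) for K = 3 with the family (memory term `16·(1∕4)·1 = 4`, β ≡ 5 along it; `min(1, 4g_k) = 1` because
`√(16 − 5k) ≤ 4`). [cite: Balaban1987RG1, (0.20) p.256] -/
theorem runB_rgEqH (hβ : ∀ (k : ℕ) (p : Fin (k + 1) → ℝ), β k p = 1 + 16 * max 0 (1 / 2 - p 0) * min 1 (4 * p (Fin.last k)))
    {gB : ℕ → ℝ} (hB : ∀ k : ℕ, gB k = 1 / Real.sqrt (16 - 5 * (k : ℝ))) : RGEqH 3 β gB := by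
  have key : ∀ a : ℝ, 0 ≤ a → 1 / (1 / Real.sqrt a) ^ 2 = a := fun a ha => by
    rw [div_pow, one_pow, Real.sq_sqrt ha, one_div_one_div]
  have h16 : Real.sqrt 16 = 4 := by rw [show (16 : ℝ) = 4 ^ 2 by norm_num]; exact Real.sqrt_sq (by norm_num)
  have hB0 : gB 0 = 1 / 4 := by rw [hB]; simp [h16]
  intro k hk
  have hkr : (k : ℝ) ≤ 2 := by exact_mod_cast (by omega : k ≤ 2)
  have hpos : 0 < Real.sqrt (16 - 5 * (k : ℝ)) := Real.sqrt_pos.mpr (by linarith)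
  have hle : Real.sqrt (16 - 5 * (k : ℝ)) ≤ 4 := by
    rw [← h16]; exact Real.sqrt_le_sqrt (by linarith)
  have hmin : min 1 (4 * gB k) = 1 := by
    rw [hB k, min_eq_left_iff.mpr]
    rw [mul_one_div, le_div_iff₀ hpos]; linarith
  rw [hβ, prefixOf_apply, Fin.val_zero, hB0, prefixOf_apply, Fin.val_last, hmin]
  rw [show (1 : ℝ) + 16 * max 0 (1 / 2 - 1 / 4) * 1 = 5 by norm_num]
  rw [hB k, hB (k + 1), key _ (by linarith), key _ (by push_cast; linarith)]
  push_cast; ring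

/-- Both runs lie in the box ]0, 1] through K = 3. [folklore] -/
theorem runs_box {gA gB : ℕ → ℝ} (hA : ∀ k : ℕ, gA k = 1 / Real.sqrt (4 - (k : ℝ)))
    (hB : ∀ k : ℕ, gB k = 1 / Real.sqrt (16 - 5 * (k : ℝ))) :
    (∀ i, i ≤ 3 → 0 < gA i ∧ gA i ≤ 1) ∧ (∀ i, i ≤ 3 → 0 < gB i ∧ gB i ≤ 1) := by
  have key : ∀ a : ℝ, 1 ≤ a → 0 < 1 / Real.sqrt a ∧ 1 / Real.sqrt a ≤ 1 := fun a ha => by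
    have h1 : 1 ≤ Real.sqrt a := by rw [← Real.sqrt_one]; exact Real.sqrt_le_sqrt ha
    exact ⟨one_div_pos.mpr (by linarith), (div_le_one (by linarith)).mpr h1⟩
  refine ⟨fun i hi => ?_, fun i hi => ?_⟩
  · have hir : (i : ℝ) ≤ 3 := by exact_mod_cast hi
    rw [hA]; exact key _ (by linarith)
  · have hir : (i : ℝ) ≤ 3 := by exact_mod_cast hi
    rw [hB]; exact key _ (by linarith)

/-- The two runs are PINNED at the same renormalized coupling `g_3 = 1` and have DIFFERENT bare couplings `1∕2 ≠ 1∕4`. [folklore] -/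
theorem runs_pin_and_bare {gA gB : ℕ → ℝ} (hA : ∀ k : ℕ, gA k = 1 / Real.sqrt (4 - (k : ℝ)))
    (hB : ∀ k : ℕ, gB k = 1 / Real.sqrt (16 - 5 * (k : ℝ))) : gA 3 = gB 3 ∧ gA 0 ≠ gB 0 := by
  have h4 : Real.sqrt 4 = 2 := by rw [show (4 : ℝ) = 2 ^ 2 by norm_num]; exact Real.sqrt_sq (by norm_num)
  have h16 : Real.sqrt 16 = 4 := by rw [show (16 : ℝ) = 4 ^ 2 by norm_num]; exact Real.sqrt_sq (by norm_num)
  refine ⟨by rw [hA, hB]; norm_num, ?_⟩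
  rw [hA, hB]; simp [h4, h16]

/-! ## §4 ENDs: the smallness is load-bearing; the same family is unique on a small box for every cutoff -/

/-- **THE ROW-SUM SMALLNESS IS LOAD-BEARING (and fading memory is not what is missing).**  There is a history family `β` with a
PRINTED split (one-loop part `1`, remainder vanishing at `g_k = 0` and `≤ 32·g_k` = (AF-1)), floor AND sign `β ≥ 1` on every box
(`BetaLowerH 1 1 β`), two-sided bound `β ≤ 9`, joint continuity, a history-Lipschitz modulus on ]0,1] with nonnegative entries and
ROW total weight `≤ 48` — every binder of (E32) `eq_of_pin_rowSum_sign` on the unit box with `b = 1`, `k₀ = 0`, `M = 48` EXCEPT the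
smallness (`48·(1 + 2) = 144 ≥ 1`) — such that NO history-Lipschitz modulus of `β` on ]0,1] has fading memory (`Λ′ k 0 ≥ 16` at every
scale; `¬FadingMemory C θ Λ′` for all `C`, `θ < 1`), AND two runs of (0.20) of length `3` in ]0,1] pinned at the same `g_3` with
DIFFERENT bare couplings exist: the tuned bare coupling is NOT unique.  (Witness: `β_{k+1} = 1 + 16·(1∕2 − g_0)₊·min(1,4g_k)`,
`1∕g² = (4,3,2,1)` and `(16,11,6,1)`.)  TEST OBJECT for hypothesis shapes; nothing of [I] asserted. [folklore] -/
theorem rowSum_smallness_loadBearing :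
    ∃ (β : HBeta) (S : B12Beta.OneLoopSplit β) (Λ : ℕ → ℕ → ℝ) (gA gB : ℕ → ℝ),
      (∀ k, S.β0 k = 1) ∧ (∀ k p, p ∈ Box 1 k → |S.β1 k p| ≤ 32 * p (Fin.last k)) ∧
      BetaLowerH 1 1 β ∧ BetaUpperH 9 1 β ∧ BetaContH 1 β ∧
      HistLipschitz Λ 1 β ∧ (∀ k i, i ≤ k → 0 ≤ Λ k i) ∧ (∀ k, ∑ i ∈ range (k + 1), Λ k i ≤ 48) ∧
      (∀ Λ' : ℕ → ℕ → ℝ, HistLipschitz Λ' 1 β →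
        (∀ k, 16 ≤ Λ' k 0) ∧ ∀ C θ : ℝ, 0 ≤ θ → θ < 1 → ¬ FadingMemory C θ Λ') ∧
      RGEqH 3 β gA ∧ RGEqH 3 β gB ∧ (∀ i, i ≤ 3 → 0 < gA i ∧ gA i ≤ 1) ∧ (∀ i, i ≤ 3 → 0 < gB i ∧ gB i ≤ 1) ∧
      gA 3 = gB 3 ∧ gA 0 ≠ gB 0 := by
  set β : HBeta := fun k p => 1 + 16 * max 0 (1 / 2 - p 0) * min 1 (4 * p (Fin.last k)) with hβdef
  have hβ : ∀ (k : ℕ) (p : Fin (k + 1) → ℝ), β k p = 1 + 16 * max 0 (1 / 2 - p 0) * min 1 (4 * p (Fin.last k)) :=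
    fun _ _ => rfl
  obtain ⟨S, hS0, hS1⟩ := fam_split hβ
  set gA : ℕ → ℝ := fun k => 1 / Real.sqrt (4 - (k : ℝ)) with hAdef
  set gB : ℕ → ℝ := fun k => 1 / Real.sqrt (16 - 5 * (k : ℝ)) with hBdef
  have hA : ∀ k : ℕ, gA k = 1 / Real.sqrt (4 - (k : ℝ)) := fun _ => rfl
  have hB : ∀ k : ℕ, gB k = 1 / Real.sqrt (16 - 5 * (k : ℝ)) := fun _ => rfl
  obtain ⟨hAbox, hBbox⟩ := runs_box hA hB
  obtain ⟨hpin, hbare⟩ := runs_pin_and_bare hA hB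
  refine ⟨β, S, fun k i => (if i = 0 then 16 else 0) + (if i = k then 32 else 0), gA, gB, hS0,
    fun k p hp => by rw [hS1]; exact fam_af1 hp, fam_lower hβ 1, fam_upper hβ 1, fam_cont hβ 1, fam_histLipschitz hβ 1,
    fun k i hik => (fam_rowSum k).1 i hik, fun k => (fam_rowSum k).2,
    fun Λ' hL => ⟨fam_weight_ge hβ (by norm_num) hL, fun C θ hθ0 hθ1 => fam_not_fadingMemory hβ (by norm_num) hL hθ0 hθ1⟩,
    runA_rgEqH hβ hA, runB_rgEqH hβ hB, hAbox, hBbox, hpin, hbare⟩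

/-- **THE SAME FAMILY IS UNIQUE ON A SMALL BOX, FOR EVERY CUTOFF** ((E32) `eq_of_pin_rowSum_sign` BY NAME with `b = 1`, `k₀ = 0`,
`M = 48`): on ]0,γ] with `γ ≤ 1∕100` the smallness `48·(γ³ + 2γ) < 1` holds, so two runs of (0.20) of ANY length `K` in ]0,γ] pinned at
the same `g_K` coincide — same memory (no fading, unbounded column), same floor; only the ratio `M·γ∕b` changed. [cite: Balaban1987RG1, Thm 2 p.259] -/
theorem unique_on_small_box
    (hβ : ∀ (k : ℕ) (p : Fin (k + 1) → ℝ), β k p = 1 + 16 * max 0 (1 / 2 - p 0) * min 1 (4 * p (Fin.last k)))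
    {γ : ℝ} (hγ : 0 < γ) (hγs : γ ≤ 1 / 100) {K : ℕ} {gA gB : ℕ → ℝ} (hA : RGEqH K β gA) (hB : RGEqH K β gB)
    (hAbox : ∀ i, i ≤ K → 0 < gA i ∧ gA i ≤ γ) (hBbox : ∀ i, i ≤ K → 0 < gB i ∧ gB i ≤ γ) (hpin : gA K = gB K) :
    ∀ j, j ≤ K → gA j = gB j := by
  have hlo1 := fam_lower hβ γ
  refine eq_of_pin_rowSum_sign (b := 1) (k₀ := 0) (M := 48) one_pos hA hB hAbox hBbox (fam_histLipschitz hβ γ)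
    (fun k i hik => (fam_rowSum k).1 i hik) (by norm_num) (fun k => (fam_rowSum k).2)
    (fun k p hp => zero_le_one.trans (hlo1 k p hp)) (eventualLowerH_of_betaLowerH hlo1 0) ?_ hpin
  have h3 : γ ^ 3 ≤ γ * (1 / 100) ^ 2 := by
    rw [pow_succ, pow_succ, pow_one]; rw [sq]
    exact mul_le_mul (mul_le_mul le_rfl hγs hγ.le hγ.le) hγs hγ.le (by positivity) |>.trans (by nlinarith)
  push_cast
  nlinarith [h3]

end Summit.QuantumFields.BalabanUV.Beta.EriceRemainderEnclosureHistoryUniquenessSharp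

end
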